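import Literature.NumberTheory.GaloisCohomology.CyclotomicTowerMuKillingReal
import HarnessLib

/-!
# A class of `H²(Γ_K, μ_N)` vanishing at the real places and off a finite set `S` dies on an open normal subgroup
# whose local index at every `v ∈ S` is divisible by `N` (K4 `SignedControlAtTwo`, base case of Milne I 4.10 (c)₃, brick B2)

Route `ThetaPartnerAtTwo` (TP2), crux K4 `SignedControlAtTwo` (stmt-BirchSwinnertonDyer-20309), line `eulerchar` v12, stub
`stub_poitouTateThreeRealRat`; width seat `bsd-wall-tp2-p3-w2` gen 7 (`--supports stmt-BirchSwinnertonDyer-20309`, helper).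
Brick B2 of the `hbase` road (`Cruxes/SignedControlAtTwo/HBASE-ROAD-w2g7.md`): the QUADRATIC (in fact: any open normal subgroup)
variant of the tree's killing theorem `exists_resH_comap_span_pow_kummer_eq_zero_of_forall_isReal`
(`CyclotomicTowerMuKillingReal.lean`, Serre II §4.4 / Tate VII §10), with the `ℤ_p`-tower replaced by ONE open normal subgroup
`U ⊴ Γ_K` and the tower's local-index growth replaced by the hypothesis that the local trace of `U` at each `v ∈ S` has index
divisible by `N`:

* `resH_kummer_eq_zero_of_dvd_localIndex` — for `c ∈ H²(Γ_K, μ_N)` with `loc_v c = 0` for the finite `v ∉ S`, `loc_w c = 0` at every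
  real `w`, and `N ∣ [Γ_{K_v} : res_v⁻¹(U)]` for `v ∈ S`: `res_U (Kummer c) = 0` in `H²(U, K̄ˣ)`.  Same proof as the tree theorem
  (local splittings by `exists_cob_on_subgroup_of_pow_eq_one_of_dvd_index'`, transport to the places of the fixed field `K_U` by
  `exists_cob_adicCompletion_baseChange_of_subgroup` / `exists_cob_infinitePlace_baseChange`, Brauer–Hasse–Noether over `K_U`
  `twoCocycle_cob_of_locallyTrivial`, transport back along `K̄ ≅ K̄_U`).

Use (B2 of the road, `N = 2`, `U = Γ_{K(√e)}` with `e` a non-square in `K_v` for `v ∈ S`): a real-trivial class of `H²(K, μ₂)` dies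
on a quadratic extension, hence is a cyclic class (tree `exists_eq_cupProduct_δ₀_of_resH_eq_zero`).
HONEST FRAMING: THEOREMS ONLY (no definition, no named fact, no `sorry`); closes no item; BSD is not proved by any of this.
References: [SerreGaloisCohomology1997] II §4.4 Prop. 13, II §3.3 Prop. 9; [CasselsFrohlichANT1967] Ch. VII §9.6–§10.
-/

set_option autoImplicit false
-- the Theorems namespace of this sub repeats the summit name by design (D-0017 nested layout)
set_option linter.dupNamespace false

noncomputable section

open CategoryTheory Function Field NumberField IsDedekindDomain
open scoped NumberField
open _root_.TopRep _root_.ContRepresentation _root_.ContinuousCohomology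
open Literature.NumberTheory.GaloisRepresentations
open Literature.NumberTheory.GaloisRepresentations.DiscreteGaloisModule
open Literature.NumberTheory.GaloisRepresentations.LocalWeilDatum
open Literature.NumberTheory.GaloisCohomology
open Literature.AnabelianGeometry.AbsoluteAnabelian
open Literature.AnabelianGeometry.AbsoluteAnabelian.Prop121vii

namespace Summit.BirchSwinnertonDyer.BirchSwinnertonDyer.Theorems.SignedEC.ShaThreeBase

universe u

variable (K : Type) [Field K] [NumberField K]

/-- **A class of `H²(Γ_K, μ_N)` with support in `S`, vanishing at the real places, dies on an open normal subgroup `U` whose local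
index at each `v ∈ S` is divisible by `N`**: `res_U (Kummer c) = 0` in `H²(U, K̄ˣ)` (local splittings + Brauer–Hasse–Noether over the
fixed field of `U`; the tree's `exists_resH_comap_span_pow_kummer_eq_zero_of_forall_isReal` with a constant tower).
[cite: SerreGaloisCohomology1997, II §4.4 Prop. 13 (with Lemme 1) and II §3.3 Prop. 9] [cite: CasselsFrohlichANT1967, Ch. VII §9.6–§10] -/
theorem resH_kummer_eq_zero_of_dvd_localIndex (U : Subgroup (absoluteGaloisGroup K)) [hUn : U.Normal]
    (hUo : IsOpen (U : Set (absoluteGaloisGroup K)))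
    {N : ℕ} [NeZero N] (c : galoisCohomology (mu K N) 2) (S : Finset (HeightOneSpectrum (𝓞 K)))
    (hS : ∀ v ∉ S, galoisCohomology.localization (mu K N) (Sum.inr v) 2 c = 0)
    (hbad : ∀ v ∈ S, N ∣ (U.comap ((absGaloisRestrict K (v.adicCompletion K) :
        absoluteGaloisGroup (v.adicCompletion K) →ₜ* absoluteGaloisGroup K) :
        absoluteGaloisGroup (v.adicCompletion K) →* absoluteGaloisGroup K)).index)
    (hreal : ∀ w : InfinitePlace K, w.IsReal →
      haveI : CompactSpace (absoluteGaloisGroup K) := absoluteGaloisGroup_compactSpace K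
      haveI : CompactSpace (absoluteGaloisGroup w.Completion) := absoluteGaloisGroup_compactSpace _
      galoisCohomology.localization (mu K N) (Sum.inl w) 2 c = 0) :
    haveI : CompactSpace (absoluteGaloisGroup K) := absoluteGaloisGroup_compactSpace K
    resH U (units K) 2 ((cohomologyMap (kummerι K N) 2).hom c) = 0 := by
  classical
  haveI : CompactSpace (absoluteGaloisGroup K) := absoluteGaloisGroup_compactSpace K
  -- a `μ_N`-valued cocycle `e` representing `c`, and its Kummer image `F`
  obtain ⟨f, hf⟩ := twoCocycleClass_surjective (mu K N).toTopRep c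
  set e : absoluteGaloisGroup K → absoluteGaloisGroup K → (AlgebraicClosure K)ˣ :=
    fun σ τ => muVal K N (f.1 (σ, τ)) with he_def
  have he_val : ∀ σ τ, e σ τ = muVal K N (f.1 (σ, τ)) := fun _ _ => rfl
  have he_lc : IsLocallyConstant fun q : absoluteGaloisGroup K × absoluteGaloisGroup K => e q.1 q.2 :=
    ((IsLocallyConstant.iff_continuous f.1).2 f.1.continuous).comp (muVal K N)
  have he_coc : ∀ σ τ υ, e σ τ * e (σ * τ) υ = σ • e τ υ * e σ (τ * υ) := fun σ τ υ => by
    have h := congrArg (muVal K N) (f.2 σ τ υ)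
    rw [muVal_add, muVal_add] at h
    change σ • e τ υ * e σ (τ * υ) = e (σ * τ) υ * e σ τ at h
    rw [h, mul_comm]
  have he_pow : ∀ σ τ, e σ τ ^ N = 1 := fun σ τ => muVal_pow_eq_one K N _
  set F : contTwoCocycles (units K).toTopRep :=
    contTwoCocycles.pullback (ContinuousMonoidHom.id _) (resIdHom (kummerι K N)) f with hF_def
  have hF : ∀ σ τ, F.1 (σ, τ) = UnitsCarrier.ofUnits (e σ τ) := fun _ _ => rfl
  have hKc : (cohomologyMap (kummerι K N) 2).hom c = twoCocycleClass _ F := by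
    rw [← hf]; exact cohomologyMap_twoCocycleClass (kummerι K N) f
  -- the local splittings at the infinite places of `K` (complex: trivial group; real: hypothesis)
  have hinfK : ∀ w : InfinitePlace K,
      ∃ b : absoluteGaloisGroup w.Completion → (AlgebraicClosure w.Completion)ˣ,
        IsLocallyConstant b ∧ ∀ x y,
          Units.map (absClosureEmbedding K w.Completion : AlgebraicClosure K →* AlgebraicClosure w.Completion)
            (e (absGaloisRestrict K w.Completion x) (absGaloisRestrict K w.Completion y)) =
          b x * x • b y / b (x * y) := by
    intro w
    rcases w.isReal_or_isComplex with hw | hw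
    · exact exists_cob_infinitePlace_of_localization_eq_zero w c f hf (hreal w hw)
    · haveI := subsingleton_absoluteGaloisGroup_completion_of_isComplex w hw
      refine ⟨fun _ => Units.map (absClosureEmbedding K w.Completion : AlgebraicClosure K →* AlgebraicClosure w.Completion)
          (e (absGaloisRestrict K w.Completion 1) (absGaloisRestrict K w.Completion 1)),
        IsLocallyConstant.const _, fun x y => ?_⟩
      rw [Subsingleton.elim x 1, Subsingleton.elim y 1, one_smul, mul_one, mul_div_cancel_right]
  -- notation: the constant "tower" `V m = U`
  set V : ℕ → Subgroup (absoluteGaloisGroup K) := fun _ => U with hV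
  have hVn : ∀ m, (V m).Normal := fun _ => hUn
  have hVo : ∀ m, IsOpen ((V m : Subgroup (absoluteGaloisGroup K)) : Set (absoluteGaloisGroup K)) := fun _ => hUo
  -- the local statement at a finite place `v` for the layer `m`
  let P : HeightOneSpectrum (𝓞 K) → ℕ → Prop := fun v m =>
    ∃ b : ((V m).comap ((absGaloisRestrict K (v.adicCompletion K) :
          absoluteGaloisGroup (v.adicCompletion K) →ₜ* absoluteGaloisGroup K) :
          absoluteGaloisGroup (v.adicCompletion K) →* absoluteGaloisGroup K)) →
        (AlgebraicClosure (v.adicCompletion K))ˣ,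
      IsLocallyConstant b ∧ ∀ x y : (V m).comap ((absGaloisRestrict K (v.adicCompletion K) :
          absoluteGaloisGroup (v.adicCompletion K) →ₜ* absoluteGaloisGroup K) :
          absoluteGaloisGroup (v.adicCompletion K) →* absoluteGaloisGroup K),
        Units.map (absClosureEmbedding K (v.adicCompletion K) :
            AlgebraicClosure K →* AlgebraicClosure (v.adicCompletion K))
          (e (absGaloisRestrict K (v.adicCompletion K) (x : absoluteGaloisGroup (v.adicCompletion K)))
            (absGaloisRestrict K (v.adicCompletion K) (y : absoluteGaloisGroup (v.adicCompletion K)))) =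
        b x * (x : absoluteGaloisGroup (v.adicCompletion K)) • b y / b (x * y)
  -- bad places: the local index of `U` is divisible by `N`, so the `N`-torsion cocycle splits there
  have hP : ∀ v : HeightOneSpectrum (𝓞 K), v ∈ S → ∀ m, P v m := by
    intro v hv m
    haveI : CharZero (v.adicCompletion K) := charZero_adicCompletion v
    obtain ⟨hlc', hcoc'⟩ := twoCocycle_baseChange K (v.adicCompletion K) e he_lc he_coc
    have hpow' : ∀ σ τ : absoluteGaloisGroup (v.adicCompletion K),
        Units.map (absClosureEmbedding K (v.adicCompletion K) :
            AlgebraicClosure K →* AlgebraicClosure (v.adicCompletion K))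
          (e (absGaloisRestrict K (v.adicCompletion K) σ) (absGaloisRestrict K (v.adicCompletion K) τ)) ^ N = 1 :=
      fun σ τ => by rw [← map_pow, he_pow, map_one]
    have hopen : IsOpen (((V m).comap ((absGaloisRestrict K (v.adicCompletion K) :
          absoluteGaloisGroup (v.adicCompletion K) →ₜ* absoluteGaloisGroup K) :
          absoluteGaloisGroup (v.adicCompletion K) →* absoluteGaloisGroup K) :
        Subgroup (absoluteGaloisGroup (v.adicCompletion K))) : Set (absoluteGaloisGroup (v.adicCompletion K))) :=
      (hVo m).preimage (absGaloisRestrict K (v.adicCompletion K)).continuous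
    exact exists_cob_on_subgroup_of_pow_eq_one_of_dvd_index' (v.adicCompletion K) _ hlc' hcoc' hpow' _
      hopen (hbad v hv)
  -- good places: the class is locally trivial, every layer works
  have hgood : ∀ v ∉ S, ∀ m, P v m := by
    intro v hv m
    haveI : CharZero (v.adicCompletion K) := charZero_adicCompletion v
    haveI : CompactSpace (absoluteGaloisGroup (v.adicCompletion K)) :=
      absoluteGaloisGroup_compactSpace (v.adicCompletion K)
    set res := absGaloisRestrict K (v.adicCompletion K) with hres
    obtain ⟨φu, hφu⟩ := exists_unitsHom (F := K) (v.adicCompletion K)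
    have h0 : Prop121vii.resMu K (v.adicCompletion K) N 2 c = 0 := by
      rw [← cohomologyMap_muLocalIso_localization, hS v hv]; exact map_zero _
    have h1 : (ContinuousCohomology.map res φu 2).hom (twoCocycleClass _ F) = 0 := by
      rw [← hKc, ← cohomologyMap_kummerι_resMu K (v.adicCompletion K) N φu hφu 2 c, h0]; exact map_zero _
    have h2 : twoCocycleClass _ (contTwoCocycles.pullback res φu F) = 0 := by
      rw [← map_twoCocycleClass]; exact h1
    have hFv : ∀ x y : absoluteGaloisGroup (v.adicCompletion K),
        (contTwoCocycles.pullback res φu F).1 (x, y) = UnitsCarrier.ofUnits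
          (Units.map (absClosureEmbedding K (v.adicCompletion K) :
            AlgebraicClosure K →* AlgebraicClosure (v.adicCompletion K)) (e (res x) (res y))) := by
      intro x y
      rw [contTwoCocycles.pullback_apply, hF, hφu]
    obtain ⟨b, hb_lc, hb⟩ := (twoCocycleClass_eq_zero_iff_exists_mul (F := v.adicCompletion K) _ _ hFv).mp h2
    exact ⟨fun x => b x, hb_lc.comp_continuous continuous_subtype_val, fun x y => hb x y⟩
  -- every finite place works
  obtain ⟨m, hmP⟩ : ∃ m : ℕ, ∀ v, P v m := by
    refine ⟨0, fun v => ?_⟩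
    by_cases hvS : v ∈ S
    · exact hP v hvS 0
    · exact hgood v hvS 0
  haveI : (V m).Normal := hVn m
  change resH (V m) (units K) 2 ((cohomologyMap (kummerι K N) 2).hom c) = 0
  -- the fixed field `K_m` of `V_m`, a number field
  obtain ⟨Km, hKmfin, hKm⟩ := exists_galFixing_eq_of_isOpen (V m) (hVo m)
  haveI : FiniteDimensional K Km := hKmfin
  haveI : CharZero Km := charZero_of_injective_algebraMap (algebraMap K Km).injective
  haveI : NumberField Km :=
    { to_charZero := inferInstance
      to_finiteDimensional := Module.Finite.trans K Km }
  haveI : Algebra.IsAlgebraic K Km := Algebra.IsAlgebraic.of_finite K Km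
  -- `res(Γ_{K_m}) = V_m`
  obtain ⟨τ, hτ⟩ := exists_range_absGaloisRestrict_eq_map_conj K Km
  have hVconj : (V m).map (MulAut.conj τ).toMonoidHom = V m := by
    ext x
    constructor
    · rintro ⟨y, hy, rfl⟩
      exact (hVn m).conj_mem y hy τ
    · intro hx
      refine ⟨τ⁻¹ * x * τ, ?_, ?_⟩
      · have := (hVn m).conj_mem x hx τ⁻¹
        rwa [inv_inv] at this
      · change τ * (τ⁻¹ * x * τ) * τ⁻¹ = x
        group
  have hrange : ((absGaloisRestrict K Km : absoluteGaloisGroup Km →ₜ* absoluteGaloisGroup K) :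
      absoluteGaloisGroup Km →* absoluteGaloisGroup K).range = V m := by
    rw [hτ, hKm, hVconj]
  have hVres : ∀ σ : absoluteGaloisGroup Km, absGaloisRestrict K Km σ ∈ V m := fun σ => by
    rw [← hrange]; exact ⟨σ, rfl⟩
  -- the base change of `e` to `Γ_{K_m}` is locally trivial everywhere
  obtain ⟨he'_lc, he'_coc⟩ := twoCocycle_baseChange K Km e he_lc he_coc
  have hfin' := fun w' : HeightOneSpectrum (𝓞 Km) =>
    exists_cob_adicCompletion_baseChange_of_subgroup e he_lc he_coc (V m) hVres w' (hmP (w'.under (𝓞 K)))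
  have hinf' : ∀ w : InfinitePlace Km,
      ∃ b : absoluteGaloisGroup w.Completion → (AlgebraicClosure w.Completion)ˣ,
        IsLocallyConstant b ∧ ∀ x y,
          Units.map (absClosureEmbedding Km w.Completion : AlgebraicClosure Km →* AlgebraicClosure w.Completion)
            (Units.map (absClosureEmbedding K Km : AlgebraicClosure K →* AlgebraicClosure Km)
              (e (absGaloisRestrict K Km (absGaloisRestrict Km w.Completion x))
                (absGaloisRestrict K Km (absGaloisRestrict Km w.Completion y)))) =
          b x * x • b y / b (x * y) := fun w' =>
    exists_cob_infinitePlace_baseChange e he_lc he_coc w' (hinfK (w'.comap (algebraMap K Km)))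
  -- ABHN over `K_m`: `e' = ∂b'`
  obtain ⟨b', hb'_lc, hb'⟩ := twoCocycle_cob_of_locallyTrivial (K := Km)
    (fun x y => Units.map (absClosureEmbedding K Km : AlgebraicClosure K →* AlgebraicClosure Km)
      (e (absGaloisRestrict K Km x) (absGaloisRestrict K Km y))) he'_lc he'_coc hfin' hinf'
  clear hfin' hinf' he'_lc he'_coc hmP hgood hP
  -- transport the splitting back to `V_m = res(Γ_{K_m})` along `K̄ ≅ K̄_m`
  set i : absoluteGaloisGroup Km →ₜ* absoluteGaloisGroup K := absGaloisRestrict K Km with hi_def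
  set ιm : AlgebraicClosure K →ₐ[K] AlgebraicClosure Km := absClosureEmbedding K Km with hιm_def
  haveI : Algebra.IsAlgebraic K (AlgebraicClosure Km) := Algebra.IsAlgebraic.trans K Km (AlgebraicClosure Km)
  have hιbij : Function.Bijective ιm :=
    (Algebra.IsAlgebraic.algHom_bijective₂ ιm
      (IsAlgClosed.lift (R := K) (M := AlgebraicClosure K) (S := AlgebraicClosure Km))).1
  set ιe : AlgebraicClosure K ≃ₐ[K] AlgebraicClosure Km := AlgEquiv.ofBijective ιm hιbij with hιe_def
  have hιe : ∀ x, ιe x = ιm x := fun _ => rfl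
  have hιsmul : ∀ (x : absoluteGaloisGroup Km) (z : AlgebraicClosure Km),
      ιe.symm (x • z) = (i x) • ιe.symm z := fun x z => by
    apply ιe.injective
    rw [AlgEquiv.apply_symm_apply, hιe, hιm_def, hi_def, absGaloisRestrict_apply_smul, ← hιe ,
      AlgEquiv.apply_symm_apply]
  have hrinj : Function.Injective i := hi_def ▸ absGaloisRestrict_injective K Km
  have hrange' : ((i : absoluteGaloisGroup Km →ₜ* absoluteGaloisGroup K) :
      absoluteGaloisGroup Km →* absoluteGaloisGroup K).range = V m := by rw [hi_def]; exact hrange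
  let ψ₀ : absoluteGaloisGroup Km ≃ (V m) :=
    (Equiv.ofInjective i hrinj).trans (Equiv.setCongr (congrArg (fun H : Subgroup (absoluteGaloisGroup K) =>
      (H : Set (absoluteGaloisGroup K))) hrange'))
  have hψ₀ : Continuous ψ₀ := Continuous.subtype_mk i.continuous _
  haveI : CompactSpace (V m) := isCompact_iff_compactSpace.mp (Subgroup.isClosed_of_isOpen _ (hVo m)).isCompact
  let ψ : absoluteGaloisGroup Km ≃ₜ (V m) := hψ₀.homeoOfEquivCompactToT2
  have hψ : ∀ x, ((ψ x : V m) : absoluteGaloisGroup K) = i x := fun x => rfl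
  have hψsymm : ∀ s : V m, i (ψ.symm s) = s := fun s => by rw [← hψ, ψ.apply_symm_apply]
  have hψmul : ∀ s t : V m, ψ.symm (s * t) = ψ.symm s * ψ.symm t := fun s t => by
    apply hrinj
    rw [map_mul i (ψ.symm s) (ψ.symm t), hψsymm, hψsymm, hψsymm]
    rfl
  -- the transported cochain
  let B : V m → (AlgebraicClosure K)ˣ := fun s =>
    Units.map (ιe.symm : AlgebraicClosure Km →* AlgebraicClosure K) (b' (ψ.symm s))
  have hB_lc : IsLocallyConstant B :=
    (hb'_lc.comp_continuous ψ.symm.continuous).comp _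
  have hleft : ∀ u : (AlgebraicClosure K)ˣ,
      Units.map (ιe.symm : AlgebraicClosure Km →* AlgebraicClosure K)
        (Units.map (ιm : AlgebraicClosure K →* AlgebraicClosure Km) u) = u := fun u =>
    Units.ext (by
      rw [Units.coe_map, MonoidHom.coe_coe, Units.coe_map, MonoidHom.coe_coe, ← hιe]
      exact ιe.symm_apply_apply (u : AlgebraicClosure K))
  have hsm : ∀ (x : absoluteGaloisGroup Km) (u : (AlgebraicClosure Km)ˣ),
      Units.map (ιe.symm : AlgebraicClosure Km →* AlgebraicClosure K) (x • u) =
        (i x) • Units.map (ιe.symm : AlgebraicClosure Km →* AlgebraicClosure K) u := fun x u =>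
    Units.ext (by
      rw [Units.coe_map, MonoidHom.coe_coe, Units.coe_smul, Units.coe_smul, Units.coe_map, MonoidHom.coe_coe]
      exact hιsmul x u)
  have hBe : ∀ s t : V m, e s t = B s * (s : absoluteGaloisGroup K) • B t / B (s * t) := by
    intro s t
    have key := hb' (ψ.symm s) (ψ.symm t)
    rw [← hψmul] at key
    have key' := congrArg (Units.map (ιe.symm : AlgebraicClosure Km →* AlgebraicClosure K)) key
    rw [map_div, map_mul, hsm, hψsymm, hψsymm, hleft] at key'
    exact key'
  -- conclusion: `res_{V_m} [F] = 0`
  rw [hKc, resH_twoCocycleClass, twoCocycleClass_eq_zero_iff]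
  refine ⟨⟨fun s => UnitsCarrier.ofUnits (B s), ?_⟩, fun s t => ?_⟩
  · exact (hB_lc.comp UnitsCarrier.ofUnits).continuous
  · rw [contTwoCocycles.pullback_apply]
    change F.1 ((s : absoluteGaloisGroup K), (t : absoluteGaloisGroup K)) =
      units K (s : absoluteGaloisGroup K) (UnitsCarrier.ofUnits (B t)) - UnitsCarrier.ofUnits (B (s * t)) +
        UnitsCarrier.ofUnits (B s)
    rw [hF, units_apply_ofUnits, ← ofUnits_div, ← ofUnits_mul, hBe s t]
    congr 1
    rw [mul_comm (B s) _, mul_div_right_comm]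


end Summit.BirchSwinnertonDyer.BirchSwinnertonDyer.Theorems.SignedEC.ShaThreeBase

end
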